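import Summits.CriticalPhenomena.PercolationContinuityZ3.Theorems.PercNearOneGluingNoHeavyLowerTailSunflowerAntipodalMatching
import HarnessLib
import HarnessLib.Audit

/-!
# `NoHeavyLowerTail` (crux stmt-CriticalPhenomena-4575), abstract sunflower cubic: the SANDWICH (bijective) form of HALL–GLADKOV
# and the monotonicity / normal-form reduction of the matching problem

Support file (seat `prim-l12-p2` gen 16; `--supports stmt-CriticalPhenomena-4575`).  Nothing is asserted about the crux; no `sorry`; the one
`@[conjecture]` definition is an obligation of this programme (census-true, unproved), used only as an explicit hypothesis.
Memo: run/shared/lean/prim/prim-l12/prim-l12-p2/FINDING-g16-SANDWICH-AND-LATTICE-FORMS.md.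

SETTING (`…SunflowerHallGladkov`, `…SunflowerAntipodalMatching`): up-sets `V₁, V₂ ⊆ 2^α`, a cube `W`, complements taken inside `W`;
`V = V₁ ∪ V₂`, `K = V₁ ∩ V₂`, `Cᵢ = Vᵢ ∖ Vⱼ`, `B = (V₁ ∪ V₂)ᶜ`;  `inV V W` / `outV V W` the in/out sides of the mixed antipodal pairs of `V`
(`antipodalMatching : IN ↪ OUT along ⊆`, a bijection), `cross V₁ V₂ W` the `C₁`-sides of the `{C₁,C₂}` pairs, `kerBot V₁ V₂ W` the kernel sides
of the `{K,B}` pairs, `pos`/`neg` the two sides of the conjectured matching `HallGladkov` (`POS = (IN(V) ∖ kerBot) ⊔ cross`, `NEG = OUT(V)`).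

THIS FILE.
* `neg_eq_outV`, `mem_pos_cases`, `kerBot_subset_inV`: the dictionary `NEG = OUT(V₁ ∪ V₂)`, `POS ⊆ IN(V₁ ∪ V₂) ∪ cross`, `kerBot ⊆ IN(V₁ ∪ V₂)`.
* `SandwichHG` (typed conjecture, this work): there is an antipodal matching `ν : IN(V) ↪ OUT(V)` (`ν T ⊆ T`) TOGETHER WITH an injection
  `κ : cross ↪ kerBot` such that `ν (κ x) ⊆ x ⊆ κ x` for every cross `C₁`-side `x` — every cross pair is SANDWICHED between a kernel–bottom
  element and that element's slot.  Equivalently (memo §3): the bipartite graph `IN(V) ⊔ cross → OUT(V) ⊔ ĉross` (real slots by `⊆`, a formal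
  slot `x̂` usable only by kernel–bottom elements `k ⊇ x`) has a PERFECT matching.  Census (memo; code bij*.c, kit j128694): all 28 224 ordered
  pairs of up-sets on 4 points, 4·10⁵ / 2·10⁵ random pairs on 5 / 6 points, 0 failures; the variant with `κ x ⊇ W ∖ x` instead is FALSE on 5 points.
* `hallGladkov_of_sandwichHG`: `SandwichHG → HallGladkov` (`x ↦ ν (κ x)` on `cross`, `ν` elsewhere; injective because `κ x ∈ kerBot` is never
  in `POS`).  So `SandwichHG` is a bijective strengthening of the lane's matching conjecture (hence of `IXGen` and of ★ for sunflowers with an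
  intersecting petal, `…SunflowerHallGladkov`).
* `pairMatching_mono` (unconditional): the matching problem for `(V₁,V₂)` is implied by the one for any `(V₁',V₂')` with `Vᵢ ∖ Vⱼ ⊆ Vᵢ' ⊆ Vᵢ`
  (`POS` can only grow and every slot used for it is still a slot).  Hence WLOG (normal form) `Vᵢ = ↑(Vᵢ ∖ Vⱼ)` — every minimal set of `V₁` lies
  outside `V₂` and vice versa (`pairMatching_of_normalForm`) — and WLOG the "pure kernel" `K ∖ ↑(C₁ ∪ C₂)` is empty (memo §2; both are
  instances of the hypotheses).  Packaged: `HallGladkovNF` (the conjecture restricted to pairs generated by private families) and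
  `hallGladkov_iff_hallGladkovNF : HallGladkov ↔ HallGladkovNF` (an infinite ground type carries no nonempty finite up-set,
  `eq_empty_of_isUpperSet_of_infinite`).
-/

namespace Summit.CriticalPhenomena.PercolationContinuityZ3.Theorems.SunflowerPartition

open Finset

namespace HallGladkov

variable {α : Type*} [DecidableEq α]

/-! ## The dictionary between `pos`/`neg` and `inV`/`outV`/`cross`/`kerBot` -/

/-- `NEG(V₁,V₂) = OUT(V₁ ∪ V₂)`. [this work] -/
theorem neg_eq_outV (V₁ V₂ : Finset (Finset α)) (W : Finset α) : neg V₁ V₂ W = outV (V₁ ∪ V₂) W := by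
  ext O
  unfold neg outV
  simp only [mem_filter, mem_union, not_or]
  tauto

/-- Every `POS` set is either a cross `C₁`-side or an in-side of `V₁ ∪ V₂` that is not a kernel set. [this work] -/
theorem mem_pos_cases {V₁ V₂ : Finset (Finset α)} {W T : Finset α} (hT : T ∈ pos V₁ V₂ W) :
    T ∈ cross V₁ V₂ W ∨ (T ∈ inV (V₁ ∪ V₂) W ∧ ¬ (T ∈ V₁ ∧ T ∈ V₂)) := by
  unfold pos at hT
  unfold cross inV
  simp only [mem_filter, mem_union, not_or] at hT ⊢
  obtain ⟨hTW, h⟩ := hT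
  rcases h with ⟨hT1, hT2, hS1⟩ | ⟨hT2, hT1, hS1, hS2⟩
  · by_cases hS2 : W \ T ∈ V₂
    · exact Or.inl ⟨hTW, hT1, hT2, hS2, hS1⟩
    · exact Or.inr ⟨⟨hTW, Or.inl hT1, hS1, hS2⟩, fun h => hT2 h.2⟩
  · exact Or.inr ⟨⟨hTW, Or.inr hT2, hS1, hS2⟩, fun h => hT1 h.1⟩

/-- Kernel–bottom sets are in-sides of `V₁ ∪ V₂`. [this work] -/
theorem kerBot_subset_inV (V₁ V₂ : Finset (Finset α)) (W : Finset α) : kerBot V₁ V₂ W ⊆ inV (V₁ ∪ V₂) W := by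
  intro R hR
  unfold kerBot at hR
  unfold inV
  simp only [mem_filter, mem_union, not_or] at hR ⊢
  exact ⟨hR.1, Or.inl hR.2.1, hR.2.2.2.1, hR.2.2.2.2⟩

/-! ## The sandwich conjecture and `SandwichHG → HallGladkov` -/

/-- **SANDWICH form of HALL–GLADKOV** (this work; OPEN, census-clean — all ordered pairs of up-sets on 4 points, 4·10⁵ / 2·10⁵ random pairs on
5 / 6 points): for up-sets `V₁, V₂` and a cube `W` there are an antipodal matching `ν` of `V₁ ∪ V₂` (`IN ↪ OUT`, `ν T ⊆ T`) and an injection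
`κ : cross ↪ kerBot` with `ν (κ x) ⊆ x ⊆ κ x`.  An obligation, never a fact: use as `(h : SandwichHG)`. [status: open] -/
@[conjecture] def SandwichHG : Prop :=
  ∀ (α : Type) [DecidableEq α] (V₁ V₂ : Finset (Finset α)) (W : Finset α),
    IsUpperSet (V₁ : Set (Finset α)) → IsUpperSet (V₂ : Set (Finset α)) →
      ∃ ν κ : Finset α → Finset α,
        Set.InjOn ν (inV (V₁ ∪ V₂) W : Set (Finset α)) ∧ (∀ T ∈ inV (V₁ ∪ V₂) W, ν T ∈ outV (V₁ ∪ V₂) W ∧ ν T ⊆ T) ∧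
        Set.InjOn κ (cross V₁ V₂ W : Set (Finset α)) ∧ (∀ x ∈ cross V₁ V₂ W, κ x ∈ kerBot V₁ V₂ W ∧ x ⊆ κ x ∧ ν (κ x) ⊆ x)

/-- The sandwich form implies the matching conjecture `HallGladkov`: send a cross `C₁`-side `x` to the slot `ν (κ x)` of its kernel–bottom
partner and every other `POS` set `T` to `ν T`.  Injectivity: `κ x ∈ kerBot` is a kernel set, hence never a `POS` set. [this work] -/
theorem hallGladkov_of_sandwichHG (h : SandwichHG) : HallGladkov := by
  intro α _ V₁ V₂ W h₁ h₂
  classical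
  obtain ⟨ν, κ, hνinj, hν, hκinj, hκ⟩ := h α V₁ V₂ W h₁ h₂
  refine ⟨fun T => if T ∈ cross V₁ V₂ W then ν (κ T) else ν T, ?_, ?_⟩
  · intro T hT T' hT' hTT'
    have hTp : T ∈ pos V₁ V₂ W := hT
    have hTp' : T' ∈ pos V₁ V₂ W := hT'
    -- a `POS` set is never a kernel set
    have npos : ∀ S ∈ pos V₁ V₂ W, ¬ (S ∈ V₁ ∧ S ∈ V₂) := by
      intro S hS hK
      unfold pos at hS
      simp only [mem_filter] at hS
      rcases hS.2 with ⟨_, hS2, _⟩ | ⟨_, hS1, _, _⟩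
      · exact hS2 hK.2
      · exact hS1 hK.1
    have hker : ∀ S ∈ cross V₁ V₂ W, κ S ∈ V₁ ∧ κ S ∈ V₂ := by
      intro S hS
      have := (hκ S hS).1
      unfold kerBot at this
      simp only [mem_filter] at this
      exact ⟨this.2.1, this.2.2.1⟩
    by_cases hc : T ∈ cross V₁ V₂ W <;> by_cases hc' : T' ∈ cross V₁ V₂ W
    · simp only [hc, hc', if_true] at hTT'
      have e1 : κ T = κ T' :=
        hνinj (kerBot_subset_inV V₁ V₂ W (hκ T hc).1) (kerBot_subset_inV V₁ V₂ W (hκ T' hc').1) hTT'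
      exact hκinj hc hc' e1
    · simp only [hc, hc', if_true, if_false] at hTT'
      have hin' : T' ∈ inV (V₁ ∪ V₂) W := ((mem_pos_cases hTp').resolve_left hc').1
      have e1 : κ T = T' := hνinj (kerBot_subset_inV V₁ V₂ W (hκ T hc).1) hin' hTT'
      exact absurd (e1 ▸ hker T hc) (npos T' hTp')
    · simp only [hc, hc', if_true, if_false] at hTT'
      have hin : T ∈ inV (V₁ ∪ V₂) W := ((mem_pos_cases hTp).resolve_left hc).1
      have e1 : T = κ T' := hνinj hin (kerBot_subset_inV V₁ V₂ W (hκ T' hc').1) hTT'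
      exact absurd (e1 ▸ hker T' hc') (npos T hTp)
    · simp only [hc, hc', if_false] at hTT'
      exact hνinj ((mem_pos_cases hTp).resolve_left hc).1 ((mem_pos_cases hTp').resolve_left hc').1 hTT'
  · intro T hT
    rw [neg_eq_outV]
    by_cases hc : T ∈ cross V₁ V₂ W
    · simp only [hc, if_true]
      obtain ⟨hk, hxk, hνk⟩ := hκ T hc
      exact ⟨(hν (κ T) (kerBot_subset_inV V₁ V₂ W hk)).1, hνk⟩
    · simp only [hc, if_false]
      exact hν T ((mem_pos_cases hT).resolve_left hc).1

/-! ## Monotonicity of the matching problem and the normal form -/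

/-- If `Vᵢ ∖ Vⱼ ⊆ Vᵢ' ⊆ Vᵢ` then every `POS` set of `(V₁,V₂)` is a `POS` set of `(V₁',V₂')`. [this work] -/
theorem pos_subset_pos_of_private {V₁ V₂ V₁' V₂' : Finset (Finset α)} (h1 : V₁' ⊆ V₁) (h2 : V₂' ⊆ V₂)
    (hp1 : V₁ \ V₂ ⊆ V₁') (hp2 : V₂ \ V₁ ⊆ V₂') (W : Finset α) : pos V₁ V₂ W ⊆ pos V₁' V₂' W := by
  intro T hT
  unfold pos at hT ⊢
  simp only [mem_filter] at hT ⊢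
  refine ⟨hT.1, ?_⟩
  rcases hT.2 with ⟨hT1, hT2, hS1⟩ | ⟨hT2, hT1, hS1, hS2⟩
  · exact Or.inl ⟨hp1 (mem_sdiff.2 ⟨hT1, hT2⟩), fun h => hT2 (h2 h), fun h => hS1 (h1 h)⟩
  · exact Or.inr ⟨hp2 (mem_sdiff.2 ⟨hT2, hT1⟩), fun h => hT1 (h1 h), fun h => hS1 (h1 h), fun h => hS2 (h2 h)⟩

/-- If `Vᵢ ∖ Vⱼ ⊆ Vᵢ' ⊆ Vᵢ` (`V₁, V₂` up-sets) then a `NEG` slot of `(V₁',V₂')` lying below a `POS` set of `(V₁,V₂)` is a `NEG` slot of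
`(V₁,V₂)`. [this work] -/
theorem mem_neg_of_mem_neg' {V₁ V₂ V₁' V₂' : Finset (Finset α)} (hV₁ : IsUpperSet (V₁ : Set (Finset α)))
    (hV₂ : IsUpperSet (V₂ : Set (Finset α))) (h1 : V₁' ⊆ V₁) (h2 : V₂' ⊆ V₂) (hp1 : V₁ \ V₂ ⊆ V₁') (hp2 : V₂ \ V₁ ⊆ V₂')
    {W T O : Finset α} (hT : T ∈ pos V₁ V₂ W) (hO : O ∈ neg V₁' V₂' W) (hOT : O ⊆ T) : O ∈ neg V₁ V₂ W := by
  unfold pos at hT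
  unfold neg at hO ⊢
  simp only [mem_filter] at hT hO ⊢
  obtain ⟨hOW, hO1', hO2', hSO⟩ := hO
  have hS : W \ O ∈ V₁ ∨ W \ O ∈ V₂ := hSO.elim (fun h => Or.inl (h1 h)) (fun h => Or.inr (h2 h))
  refine ⟨hOW, ?_, ?_, hS⟩
  · intro hO1
    rcases hT.2 with ⟨_, hT2, _⟩ | ⟨_, hT1, _, _⟩
    · have hO2 : O ∉ V₂ := fun hO2 => hT2 (hV₂ hOT hO2)
      exact hO1' (hp1 (mem_sdiff.2 ⟨hO1, hO2⟩))
    · exact hT1 (hV₁ hOT hO1)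
  · intro hO2
    rcases hT.2 with ⟨_, hT2, _⟩ | ⟨_, hT1, _, _⟩
    · exact hT2 (hV₂ hOT hO2)
    · have hO1 : O ∉ V₁ := fun hO1 => hT1 (hV₁ hOT hO1)
      exact hO2' (hp2 (mem_sdiff.2 ⟨hO2, hO1⟩))

/-- **Monotonicity / normal form** (this work): if `Vᵢ ∖ Vⱼ ⊆ Vᵢ' ⊆ Vᵢ` (`i ≠ j`; `V₁, V₂` up-sets) then a `POS → NEG` matching along `⊆` for
`(V₁', V₂')` restricts to one for `(V₁, V₂)`.  Instances: `Vᵢ' = ↑(Vᵢ ∖ Vⱼ)` (so WLOG every minimal set of `V₁` lies outside `V₂` and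
vice versa) and `Vᵢ' = Vᵢ ∖ K°` with `K° = (V₁ ∩ V₂) ∖ ↑((V₁ ∖ V₂) ∪ (V₂ ∖ V₁))` (so WLOG every kernel set contains a petal set). [this work] -/
theorem pairMatching_mono {V₁ V₂ V₁' V₂' : Finset (Finset α)} (hV₁ : IsUpperSet (V₁ : Set (Finset α)))
    (hV₂ : IsUpperSet (V₂ : Set (Finset α))) (h1 : V₁' ⊆ V₁) (h2 : V₂' ⊆ V₂) (hp1 : V₁ \ V₂ ⊆ V₁') (hp2 : V₂ \ V₁ ⊆ V₂')
    (W : Finset α)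
    (h : ∃ φ : Finset α → Finset α, Set.InjOn φ (pos V₁' V₂' W : Set (Finset α)) ∧ ∀ T ∈ pos V₁' V₂' W, φ T ∈ neg V₁' V₂' W ∧ φ T ⊆ T) :
    ∃ φ : Finset α → Finset α, Set.InjOn φ (pos V₁ V₂ W : Set (Finset α)) ∧ ∀ T ∈ pos V₁ V₂ W, φ T ∈ neg V₁ V₂ W ∧ φ T ⊆ T := by
  obtain ⟨φ, hinj, hφ⟩ := h
  have hsub := pos_subset_pos_of_private h1 h2 hp1 hp2 W
  refine ⟨φ, hinj.mono (fun T hT => Finset.mem_coe.2 (hsub (Finset.mem_coe.1 hT))), fun T hT => ?_⟩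
  obtain ⟨hO, hOT⟩ := hφ T (hsub hT)
  exact ⟨mem_neg_of_mem_neg' hV₁ hV₂ h1 h2 hp1 hp2 hT hO hOT, hOT⟩

/-- The up-closure of a family inside `Finset α`. [folklore] -/
def upClosure [Fintype α] (X : Finset (Finset α)) : Finset (Finset α) := univ.filter fun T => ∃ S ∈ X, S ⊆ T

/-- A family is contained in its up-closure. [folklore] -/
theorem subset_upClosure [Fintype α] (X : Finset (Finset α)) : X ⊆ upClosure X := by
  intro T hT
  unfold upClosure
  exact mem_filter.2 ⟨mem_univ _, T, hT, subset_rfl⟩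

/-- The up-closure of a subfamily of an up-set stays inside the up-set. [folklore] -/
theorem upClosure_subset_of_isUpperSet [Fintype α] {X V : Finset (Finset α)} (hV : IsUpperSet (V : Set (Finset α))) (hX : X ⊆ V) :
    upClosure X ⊆ V := by
  intro T hT
  unfold upClosure at hT
  obtain ⟨_, S, hS, hST⟩ := mem_filter.1 hT
  exact hV hST (hX hS)

/-- The up-closure is an up-set. [folklore] -/
theorem isUpperSet_upClosure [Fintype α] (X : Finset (Finset α)) : IsUpperSet (upClosure X : Set (Finset α)) := by
  intro A B hAB hA
  rw [Finset.mem_coe] at hA ⊢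
  unfold upClosure at hA ⊢
  obtain ⟨_, S, hS, hSA⟩ := mem_filter.1 hA
  exact mem_filter.2 ⟨mem_univ _, S, hS, subset_trans hSA hAB⟩

/-- **Normal form** (this work): the matching problem for `(V₁, V₂)` follows from the one for the pair of up-sets GENERATED BY THE PRIVATE PARTS,
`(↑(V₁ ∖ V₂), ↑(V₂ ∖ V₁))` — a pair in which every minimal set of either up-set lies outside the other (and every kernel set contains a
petal set).  So `HallGladkov` needs to be proved only for such pairs. [this work] -/
theorem pairMatching_of_normalForm [Fintype α] {V₁ V₂ : Finset (Finset α)} (hV₁ : IsUpperSet (V₁ : Set (Finset α)))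
    (hV₂ : IsUpperSet (V₂ : Set (Finset α))) (W : Finset α)
    (h : ∃ φ : Finset α → Finset α, Set.InjOn φ (pos (upClosure (V₁ \ V₂)) (upClosure (V₂ \ V₁)) W : Set (Finset α)) ∧
      ∀ T ∈ pos (upClosure (V₁ \ V₂)) (upClosure (V₂ \ V₁)) W,
        φ T ∈ neg (upClosure (V₁ \ V₂)) (upClosure (V₂ \ V₁)) W ∧ φ T ⊆ T) :
    ∃ φ : Finset α → Finset α, Set.InjOn φ (pos V₁ V₂ W : Set (Finset α)) ∧ ∀ T ∈ pos V₁ V₂ W, φ T ∈ neg V₁ V₂ W ∧ φ T ⊆ T :=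
  pairMatching_mono hV₁ hV₂ (upClosure_subset_of_isUpperSet hV₁ sdiff_subset) (upClosure_subset_of_isUpperSet hV₂ sdiff_subset)
    (subset_upClosure _) (subset_upClosure _) W h

/-- In an infinite type a finite up-set of finite sets is empty. [folklore] -/
theorem eq_empty_of_isUpperSet_of_infinite [Infinite α] {V : Finset (Finset α)} (hV : IsUpperSet (V : Set (Finset α))) : V = ∅ := by
  by_contra hne
  obtain ⟨T, hT⟩ := Finset.nonempty_iff_ne_empty.2 hne
  obtain ⟨a, ha⟩ := Infinite.exists_notMem_finset (V.biUnion id)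
  have h1 : insert a T ∈ V := hV (Finset.subset_insert a T) hT
  exact ha (mem_biUnion.2 ⟨insert a T, h1, mem_insert_self a T⟩)

/-- **HALL–GLADKOV in normal form** (this work; OPEN, equivalent to `HallGladkov` by `hallGladkov_iff_hallGladkovNF`): it suffices to match
pairs of up-sets generated by "private" families `C₁, C₂` (no set of `C₁` contains a set of `C₂` and vice versa), i.e. pairs in which every
minimal set of `V₁ = ↑C₁` lies outside `V₂ = ↑C₂` and conversely.  An obligation, never a fact. [status: open] -/
@[conjecture] def HallGladkovNF : Prop :=
  ∀ (α : Type) [Fintype α] [DecidableEq α] (C₁ C₂ : Finset (Finset α)) (W : Finset α),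
    (∀ c ∈ C₁, c ∉ upClosure C₂) → (∀ c ∈ C₂, c ∉ upClosure C₁) →
      ∃ φ : Finset α → Finset α, Set.InjOn φ (pos (upClosure C₁) (upClosure C₂) W : Set (Finset α)) ∧
        ∀ T ∈ pos (upClosure C₁) (upClosure C₂) W, φ T ∈ neg (upClosure C₁) (upClosure C₂) W ∧ φ T ⊆ T

/-- `HallGladkov` is equivalent to its normal form. (`→`: instantiate; `←`: `pairMatching_of_normalForm` with `Cᵢ = Vᵢ ∖ Vⱼ`, which are
private because `Vⱼ` is an up-set; an infinite ground type carries no nonempty finite up-set.) [this work] -/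
theorem hallGladkov_iff_hallGladkovNF : HallGladkov ↔ HallGladkovNF := by
  constructor
  · intro h α _ _ C₁ C₂ W _ _
    exact h α (upClosure C₁) (upClosure C₂) W (isUpperSet_upClosure C₁) (isUpperSet_upClosure C₂)
  · intro h α _ V₁ V₂ W h₁ h₂
    rcases finite_or_infinite α with hfin | hinf
    · haveI := Fintype.ofFinite α
      refine pairMatching_of_normalForm h₁ h₂ W (h α (V₁ \ V₂) (V₂ \ V₁) W ?_ ?_)
      · intro c hc hcu
        unfold upClosure at hcu
        obtain ⟨_, S, hS, hSc⟩ := mem_filter.1 hcu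
        exact (mem_sdiff.1 hc).2 (h₂ hSc (mem_sdiff.1 hS).1)
      · intro c hc hcu
        unfold upClosure at hcu
        obtain ⟨_, S, hS, hSc⟩ := mem_filter.1 hcu
        exact (mem_sdiff.1 hc).2 (h₁ hSc (mem_sdiff.1 hS).1)
    · have e1 : V₁ = ∅ := eq_empty_of_isUpperSet_of_infinite h₁
      have e2 : V₂ = ∅ := eq_empty_of_isUpperSet_of_infinite h₂
      subst e1; subst e2
      refine ⟨id, Set.injOn_id _, fun T hT => ?_⟩
      unfold pos at hT
      simp only [mem_filter, Finset.notMem_empty, false_and, or_self, and_false] at hT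

end HallGladkov

end Summit.CriticalPhenomena.PercolationContinuityZ3.Theorems.SunflowerPartition
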